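import Summits.BirchSwinnertonDyer.BirchSwinnertonDyer.Theorems.PrintX10bReadoutIndexOfLocalClauses
import Summits.BirchSwinnertonDyer.Rank1Residual.Additive.ClassicalConditionAwayBadPlaces
import Literature.NumberTheory.EllipticCurves.ZpExtensionEisensteinReadoutUnramifiedConverseProofs
import Literature.NumberTheory.EllipticCurves.ZpExtensionEisensteinDVRSetting
import Literature.NumberTheory.EllipticCurves.IwasawaSelmerProofs
import HarnessLib

/-!
# Letter (B5-OFF) `Stmt.readoutLocalOff` PROVED — «no contribution at the good places»: a class of `H¹(K, T_j)` whose readout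
# is Selmer over `K_∞` satisfies Howard's condition `condA F_𝔮` ON THE NOSE at every `v ∉ S` (helper for the shared μ-crux
# `MuInequalityCoherentPairOfPrintCG`, stmt-BirchSwinnertonDyer-23428, clause (B5) `Stmt.readoutIndex`; cell `pub/bsd-print-x9`,
# seat `bsd-line-x9-p2` g6)

Summits-side helper, THEOREMS ONLY (no definition, no named fact, no instance, no `sorry`); ROUTE-INDEPENDENT (no `Theses`
import). It proves the first of the three place-wise letters of `readoutIndex_of_localClauses`
(`Theorems/PrintX10bReadoutIndexOfLocalClauses`, seat `bsd-line-x10b-p1-w2` g11):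
**`HeegnerMuPartControlGlue.stub_readoutLocalOff : Stmt.readoutLocalOff`** (with `m₁ := 0`, `j₀ := 0`) — the `hoff` input
(`S' := S`) of `WeierstrassCurve.finite_and_natCard_kerPsi_quotient_eisensteinTowerReadout_le_of_local` (p673136):

* §1 **`localization_mem_eisensteinSelmerStructure_of_eisensteinTowerReadout_mem_selmerInfty`** — for `E = W_K`, a
  topological generator `γ` of `κ`, a finite place `v ∉ S`, `v ∤ p` of good reduction and a class `c ∈ H¹(K, T^{(k)})` whose
  readout `W.eisensteinTowerReadout … (of k c)` lies in `Sel_{p^∞}(E/K_∞)`: `loc_v c ∈ F_𝔮(k+1, v) = H¹_ur(K_v, T^{(k)})`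
  (`eisensteinSelmerStructure_inr_of_not_mem`). This is the Literature brick
  `WeierstrassCurve.localization_mem_unramifiedSubgroup_of_eisensteinTowerReadout_mem` (this seat) applied to
  `𝒮 := Sel_{p^∞}(E/K_∞)`, which is `conj_γ`-stable (`map_conjH1_selmerGroupOver_le_holds`) and consists of classes
  unramified over `K_∞` at the place above `v` (Kummer ⇒ locally trivial ⇒ unramified at `v ∤ p`:
  `Rank1Residual.Additive.localKerOver_le_unramKer`, Greenberg LNM 1716 Prop. 2.1 / Greenberg–Vatsal p. 17).
* §2 **`stub_readoutLocalOff : Stmt.readoutLocalOff`** — the letter, in the currency of Howard's Eisenstein setting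
  `St := W.eisensteinDVRSetting (κ.unitTwist (-1)) hm S …`: for EVERY `m ≥ 1` (`m₁ := 0`), every admissible datum, EVERY level
  `j` (`j₀ := 0`), every `c ∈ H¹(K, T_j)` with readout in `Sel_{p^∞}(E/K_∞)` and every finite `v ∉ S` (`v ∤ p` by `hpS`, good
  reduction by `hbad`, `γ := hyp.topGenerator`): `loc_v c ∈ AdicTower.condA St.T St.π St.e … (fun k ↦ (St.t k).cond) j (Sum.inr v)`
  — indeed in `F_𝔮(j, v)` itself, the `d = 0` term of the directed union `condA`.

HONEST FRAMING: exact membership, no index and no level shift at the good places; the places `v ∈ S` ((B5-P), (B5-BAD): the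
`m`-uniform local indices) and the assembly `readoutIndex_of_localClauses` are NOT touched; «beyond-print theorem»: no
(Howard Prop. 2.2.8, second map, the good-place bookkeeping). BSD is not proved by any of this; no summit statement is
proved by this seat.

References: [Howard2004HeegnerKolyvagin] Def. 2.1.10, Lemma 2.2.7 / Prop. 2.2.8, proof of Thm. 2.2.10 (arXiv 1202.6340
p. 17 L41–53); [GreenbergLNM1716] §2 Prop. 2.1 (pp. 69–72), §4 pp. 107, 124; [GreenbergVatsal2000] §2 p. 17;
[SilvermanAEC2009] Prop. VII.4.1; [Washington1997] Prop. 13.2.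
-/

set_option linter.dupNamespace false
set_option autoImplicit false

noncomputable section

open scoped Classical Pointwise ContRepresentation TensorProduct NumberField

open Function NumberField IsDedekindDomain Field
open Literature Literature.NumberTheory.EllipticCurves WeierstrassCurve
open Literature.NumberTheory.GaloisCohomology Literature.NumberTheory.GaloisCohomology.Howard2004
open Literature.NumberTheory.GaloisRepresentations Literature.NumberTheory.GaloisRepresentations.DiscreteGaloisModule
open Literature.NumberTheory.EllipticCurves.GreenbergSelmer
open Summit.BirchSwinnertonDyer.BirchSwinnertonDyer.Theorems

namespace Summit.BirchSwinnertonDyer.BirchSwinnertonDyer.Theorems.HeegnerMuPartControlGlue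

/-! ## §1 Frame-explicit: readout Selmer over `K_∞` ⇒ `loc_v c ∈ F_𝔮(k+1, v)` at a good `v ∉ S` -/

section PerPlace

open Literature.NumberTheory.EllipticCurves.ZpExtension (EisensteinLevel)

variable {K : Type} [Field K] [NumberField K] (W : WeierstrassCurve ℚ) [W.IsElliptic]
  {p : ℕ} [hp : Fact p.Prime] (κ : ZpExtension K p) {m : ℕ} (hm : 1 ≤ m)

variable (π : IwasawaAlgebra p ⧸ Ideal.span {(PowerSeries.X ^ m + PowerSeries.C (p : ℤ_[p]) : IwasawaAlgebra p)})
  (e : ℕ → ℕ)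
  (hkill : letI := IwasawaAlgebra.isLocalRing_quotient_X_pow_add_C p hm
    ∀ k, ∀ r ∈ IsLocalRing.maximalIdeal
      (IwasawaAlgebra p ⧸ Ideal.span {(PowerSeries.X ^ m + PowerSeries.C (p : ℤ_[p]) : IwasawaAlgebra p)}) ^ e k,
      ∀ x : EisensteinLevel p m (fun j ↦ geomTorsion (W.baseChange K) ((p : ℤ) ^ j)) (k + 1), r • x = 0)
  (hker : letI := IwasawaAlgebra.isLocalRing_quotient_X_pow_add_C p hm
    ∀ k, LinearMap.ker ((W.eisensteinTower (κ.unitTwist (-1)) hm).red k) =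
      (IsLocalRing.maximalIdeal
        (IwasawaAlgebra p ⧸ Ideal.span {(PowerSeries.X ^ m + PowerSeries.C (p : ℤ_[p]) : IwasawaAlgebra p)}) ^ e k) •
        (⊤ : Submodule (IwasawaAlgebra p ⧸ Ideal.span {(PowerSeries.X ^ m + PowerSeries.C (p : ℤ_[p]) : IwasawaAlgebra p)})
          (EisensteinLevel p m (fun j ↦ geomTorsion (W.baseChange K) ((p : ℤ) ^ j)) (k + 1 + 1))))
  (hπ : letI := IwasawaAlgebra.isLocalRing_quotient_X_pow_add_C p hm
    π ∈ IsLocalRing.maximalIdeal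
      (IwasawaAlgebra p ⧸ Ideal.span {(PowerSeries.X ^ m + PowerSeries.C (p : ℤ_[p]) : IwasawaAlgebra p)}))
  (he : ∀ k, e k ≤ e (k + 1))
  (hπX : π = Ideal.Quotient.mk _ PowerSeries.X) (hek : ∀ k, e (k + 1) - e k = m)

/-- **Readout Selmer over `K_∞` ⇒ Howard's `F_𝔮` at a good `v ∉ S`, `v ∤ p`.** For a topological generator `γ` of `κ`,
`S` with good reduction off `S ∪ {v ∣ p}`, a finite place `v ∉ S` with `v ∤ p` and a class `c ∈ H¹(K, T^{(k)})` whose readout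
lies in `Sel_{p^∞}(E/K_∞)`: `loc_v c ∈ F_𝔮(k+1, v) = H¹_ur(K_v, T^{(k)})`. (`Sel_{p^∞}(E/K_∞)` is `conj_γ`-stable and its
classes are unramified over `K_∞` at `v ∤ p` — Kummer ⇒ locally trivial ⇒ unramified — so the Literature brick applies.)
[cite: Howard2004HeegnerKolyvagin, Def. 2.1.10 and Lemma 2.2.7 / Prop. 2.2.8 (arXiv p. 17 L41–53)]
[cite: GreenbergLNM1716, §2 Prop. 2.1 (pp. 69–72)] [cite: GreenbergVatsal2000, §2 p. 17] [cite: SilvermanAEC2009, Prop. VII.4.1] -/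
theorem localization_mem_eisensteinSelmerStructure_of_eisensteinTowerReadout_mem_selmerInfty
    {γ : absoluteGaloisGroup K} (hγ : κ.IsTopGenerator γ)
    (S : Finset (HeightOneSpectrum (𝓞 K)))
    (hbad : ∀ v, v ∉ S → ((p : ℕ) : 𝓞 K) ∉ v.asIdeal → (W.baseChange K).HasGoodReductionAt v)
    (v : HeightOneSpectrum (𝓞 K)) (hvS : v ∉ S) (hpv : ((p : ℕ) : 𝓞 K) ∉ v.asIdeal) (k : ℕ)
    (c : galoisCohomology
      ((κ.unitTwist (-1)).eisensteinTwist ((W.baseChange K).torsionGaloisModule ((p : ℤ) ^ (k + 1))) hm (k + 1)) 1)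
    (hc : letI := IwasawaAlgebra.isLocalRing_quotient_X_pow_add_C p hm
      W.eisensteinTowerReadout κ hm π e hkill hker hπ he hπX hek
        (AddCommGroup.DirectLimit.of _ _ k c :
          AdicTower.H1A (W.eisensteinTower (κ.unitTwist (-1)) hm) π e hkill hker hπ he) ∈ (W.baseChange K).selmerInfty κ) :
    galoisCohomology.localization
        ((κ.unitTwist (-1)).eisensteinTwist ((W.baseChange K).torsionGaloisModule ((p : ℤ) ^ (k + 1))) hm (k + 1))
        (Sum.inr v) 1 c ∈
      (κ.unitTwist (-1)).eisensteinSelmerStructure (fun j ↦ (W.baseChange K).torsionGaloisModule ((p : ℤ) ^ j))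
        (fun j ↦ (W.baseChange K).torsionGaloisModuleReduce p j) hm S
        (fun v _ ↦ (W.baseChange K).ordinaryFiltrationAt v (fun j ↦ (W.baseChange K).torsionGaloisModuleReduce p j)
          (fun _ _ ↦ rfl)) (k + 1) (Sum.inr v) := by
  letI := IwasawaAlgebra.isLocalRing_quotient_X_pow_add_C p hm
  rw [ZpExtension.eisensteinSelmerStructure_inr_of_not_mem _ _ _ _ _ _ _ hpv hvS]
  refine W.localization_mem_unramifiedSubgroup_of_eisensteinTowerReadout_mem κ hm π e hkill hker hπ he hπX hek hγ v hpv
    (hbad v hvS hpv) ((W.baseChange K).selmerInfty κ) (fun s hs ↦ ?_) (fun s hs ↦ ?_) k c hc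
  · -- `Sel_{p^∞}(E/K_∞)` is `conj_γ`-stable
    exact (W.baseChange K).map_conjH1_selmerGroupOver_le_holds p κ.kerSubgroup γ ⟨s, hs, rfl⟩
  · -- its classes are unramified over `K_∞` at the place above `v ∤ p` (Kummer ⇒ locally trivial ⇒ unramified)
    rw [WeierstrassCurve.selmerInfty, WeierstrassCurve.mem_selmerGroupOver_iff] at hs
    have h1 : s ∈ (W.baseChange K).localKerOver p κ.kerSubgroup (v.adicCompletion K) := by
      have h := hs.1 v 1
      rwa [(W.baseChange K).conjH1_one_holds p κ.kerSubgroup, AddMonoidHom.id_apply] at h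
    have h2 := Summit.BirchSwinnertonDyer.Rank1Residual.Additive.localKerOver_le_unramKer (κ := κ) (v := v)
      (W := W.baseChange K) (p := p) hpv h1
    rw [Summit.BirchSwinnertonDyer.Rank1Residual.X2.GreenbergVatsalTorsion.unramKer, AddMonoidHom.mem_ker] at h2
    exact h2

end PerPlace

/-! ## §2 Letter (B5-OFF) proved = `stub_readoutLocalOff : Stmt.readoutLocalOff` (`m₁ := 0`, `j₀ := 0`) -/

/-- **Letter (B5-OFF) `Stmt.readoutLocalOff` holds** («no contribution at the good places», `m₁ := 0`, `j₀ := 0`): on every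
`Thm413Hypotheses` frame, for every admissible Eisenstein datum, every tower level `j`, every class `c ∈ H¹(K, T_j)` whose
readout lies in `Sel_{p^∞}(E/K_∞)` and every finite `v ∉ S`, `loc_v c ∈ condA F_𝔮 (j, v)` — indeed `loc_v c ∈ F_𝔮(j, v)`
(§1 with `γ := hyp.topGenerator`; `v ∤ p` by `hpS`, good reduction by `hbad`), the `d = 0` term of the directed union
`condA`. The leading binder (CG) is not used. [cite: Howard2004HeegnerKolyvagin, Def. 2.1.10, Lemma 2.2.7 / Prop. 2.2.8 and proof of Thm. 2.2.10 (arXiv p. 17 L41–53)]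
[cite: GreenbergLNM1716, §2 Prop. 2.1 and §4 pp. 107, 124] [cite: GreenbergVatsal2000, §2 p. 17] [cite: SilvermanAEC2009, Prop. VII.4.1] -/
theorem stub_readoutLocalOff : Stmt.readoutLocalOff := by
  intro _hCG N _ W _ K _ _ p _ κ γ jbar hyp _hCM _hirr _hirrK _hsc _hHp _hhK
  haveI := hyp.isElliptic
  refine ⟨0, fun m hm _ ↦ ?_⟩
  letI := IwasawaAlgebra.isDomain_quotient_X_pow_add_C p hm
  letI := IwasawaAlgebra.isDiscreteValuationRing_quotient_X_pow_add_C p hm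
  haveI := IwasawaAlgebra.EisensteinCoeff.isLocalRing_succ p hm
  letI := IwasawaAlgebra.EisensteinCoeff.algebraOfSpecSucc p m
  haveI := W.isScalarTower_algebraOfSpecSucc (K := K) (p := p) (m := m)
  letI := W.residueModuleSucc (K := K) (p := p) hm
  intro S hpS hbad _hSN _hSσ L hL hLS jbar' cd Dd fs hy hπ he hπX hek
  refine ⟨0, fun j _ c hc v hvS ↦ ?_⟩
  have hpv : ((p : ℕ) : 𝓞 K) ∉ v.asIdeal := fun h ↦ hvS (hpS v h)
  -- `F ≤ condA F`: the `d = 0` term of the directed union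
  unfold AdicTower.condA
  refine AddSubgroup.mem_iSup_of_mem 0 ?_
  rw [AddSubgroup.mem_comap]
  exact localization_mem_eisensteinSelmerStructure_of_eisensteinTowerReadout_mem_selmerInfty W κ hm _ _ hy.killed
    hy.ker_red hπ he hπX hek hyp.topGenerator S hbad v hvS hpv j c hc

end Summit.BirchSwinnertonDyer.BirchSwinnertonDyer.Theorems.HeegnerMuPartControlGlue

end
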